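import Mathlib
import Summits.ValiantsHypothesis.ValiantsHypothesis.Theses.PartialSorting

/-!
# Route `PartialSorting`, item `HeckeStep` (stmt-ValiantsHypothesis-13596): one 0-Hecke gate per cover

We prove `Summit.ValiantsHypothesis.ValiantsHypothesis.Theses.PartialSorting.HeckeStep`: for a
permutation `w ∈ S_n` with an ascent at `k` (`w k < w (k+1)`) and `s = (k k+1)`,

  `D_{w s} = Σ_{u ≤ w, u k < u (k+1)} sgn u · (x^u − x^{u s})`,

where `D_v = Σ_{σ ≤ v} sgn σ · x^σ` and `σ ≤ v` is the Bruhat order written through the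
Björner–Brenti rank criterion `σ[i,j] ≤ v[i,j]`, `σ[i,j] := #{a ≤ i : j ≤ σ a}`
(Björner–Brenti 2005, Thm 2.1.5).

Proof.  The rank matrix of `f ∘ s` differs from that of `f` only in row `k`, where
`(f ∘ s)[k,j] = #{a < k : j ≤ f a} + [j ≤ f (k+1)]` against `f[k,j] = #{a < k : j ≤ f a} + [j ≤ f k]`
(`heckeStep_row_self`, `heckeStep_row_self_swap`, `heckeStep_rank_swap_of_ne`).  Bookkeeping with
the rows `k-1`, `k`, `k+1` gives, for `u` with an ascent at `k`, `u ≤ w s ↔ u ≤ w` and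
`u s ≤ w s ↔ u ≤ w` (`heckeStep_bruhat_iff`; this is the lifting property, Björner–Brenti 2005
Prop. 2.2.7, in rank form).  Splitting the sum over `σ ≤ w s` into ascents and descents at `k` and
reindexing the descents by `σ ↦ σ s` (sign flips, `Equiv.Perm.sign_swap`) gives the identity
(`heckeStep_sum_split`).  Everything is elementary and self-contained (Mathlib has no Bruhat order).
-/

namespace Summit.ValiantsHypothesis.ValiantsHypothesis.Theorems.PartialSortingHeckeStep

-- `Summit.ValiantsHypothesis.ValiantsHypothesis.…` is the tree's mandated single-conjunct layout (Sub = Summit).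
set_option linter.dupNamespace false

open Finset

/-! ## The abstract resummation -/

/-- Abstract form of the gate identity: if `e` is an involution-like reindexing exchanging the
`A`-half and the `¬A`-half, flipping the sign `c` and carrying `m` to `m'`, and on the `A`-half
both `P` and `P ∘ e` agree with `Q`, then `Σ_{P} c • m = Σ_{Q ∧ A} c • (m − m')`. [folklore] -/
theorem heckeStep_sum_split {ι R M : Type*} [Fintype ι] [Ring R] [AddCommGroup M] [Module R M]
    (e : ι ≃ ι) (P Q A : ι → Prop) [DecidablePred P] [DecidablePred Q] [DecidablePred A]
    (c : ι → Rˣ) (m m' : ι → M)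
    (hA : ∀ u, A (e u) ↔ ¬A u) (hc : ∀ u, c (e u) = -c u) (hm : ∀ u, m (e u) = m' u)
    (h1 : ∀ u, A u → (P u ↔ Q u)) (h2 : ∀ u, A u → (P (e u) ↔ Q u)) :
    (∑ σ, if P σ then c σ • m σ else 0) = ∑ u, if Q u ∧ A u then c u • (m u - m' u) else 0 := by
  have step1 : (∑ σ, if P σ then c σ • m σ else 0) =
      (∑ σ, if P σ ∧ A σ then c σ • m σ else 0) + ∑ σ, if P σ ∧ ¬A σ then c σ • m σ else 0 := by
    rw [← Finset.sum_add_distrib]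
    refine Finset.sum_congr rfl fun σ _ => ?_
    by_cases hP : P σ <;> by_cases hAσ : A σ <;> simp [hP, hAσ]
  have step2 : (∑ σ, if P σ ∧ ¬A σ then c σ • m σ else 0) =
      ∑ u, if P (e u) ∧ ¬A (e u) then c (e u) • m (e u) else 0 :=
    (Equiv.sum_comp e (fun σ => if P σ ∧ ¬A σ then c σ • m σ else 0)).symm
  rw [step1, step2, ← Finset.sum_add_distrib]
  refine Finset.sum_congr rfl fun u _ => ?_
  by_cases hAu : A u
  · have hAe : ¬A (e u) := fun h => (hA u).1 h hAu
    by_cases hQ : Q u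
    · have hP : P u := (h1 u hAu).2 hQ
      have hPe : P (e u) := (h2 u hAu).2 hQ
      simp [hP, hPe, hAu, hAe, hQ, hc, hm, Units.neg_smul, sub_eq_add_neg]
    · have hP : ¬P u := fun h => hQ ((h1 u hAu).1 h)
      have hPe : ¬P (e u) := fun h => hQ ((h2 u hAu).1 h)
      simp [hP, hPe, hQ]
  · have hAe : A (e u) := (hA u).2 hAu
    simp [hAu, hAe]

/-! ## Rank-function bookkeeping on `Fin n` -/

section Rank

variable {n : ℕ}

/-- Peeling the top element off a rank count:
`#{a ≤ m : p a} = #{a < m : p a} + [p m]`. [folklore] -/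
theorem heckeStep_peel (p : Fin n → Prop) [DecidablePred p] (m : Fin n) :
    (univ.filter fun a : Fin n => a ≤ m ∧ p a).card =
      (univ.filter fun a : Fin n => a < m ∧ p a).card + (if p m then 1 else 0) := by
  have key : (if p m then 1 else 0) = ∑ a : Fin n, if a = m then (if p a then 1 else 0) else 0 := by
    rw [Fintype.sum_ite_eq']
  rw [key, Finset.card_filter, Finset.card_filter, ← Finset.sum_add_distrib]
  refine Finset.sum_congr rfl (fun a _ => ?_)
  rcases lt_trichotomy a m with h | rfl | h
  · simp [h, h.le, h.ne]
  · simp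
  · simp [not_le.2 h, not_lt.2 h.le, ne_of_gt h]

/-- `a < k + 1 ↔ a ≤ k` in `Fin n`. [folklore] -/
theorem heckeStep_lt_succ_iff {k k' : Fin n} (hk' : (k' : ℕ) = (k : ℕ) + 1) (a : Fin n) :
    a < k' ↔ a ≤ k := by
  rw [Fin.lt_def, Fin.le_iff_val_le_val, hk']
  omega

/-- Row `k` of the rank matrix: `f[k,j] = #{a < k : j ≤ f a} + [j ≤ f k]`. [folklore] -/
theorem heckeStep_row_self (g : Fin n → Fin n) (k j : Fin n) :
    (univ.filter fun a : Fin n => a ≤ k ∧ j ≤ g a).card =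
      (univ.filter fun a : Fin n => a < k ∧ j ≤ g a).card + (if j ≤ g k then 1 else 0) :=
  heckeStep_peel (fun a => j ≤ g a) k

/-- Row `k + 1` of the rank matrix:
`f[k+1,j] = #{a < k : j ≤ f a} + [j ≤ f k] + [j ≤ f (k+1)]`. [folklore] -/
theorem heckeStep_row_succ (g : Fin n → Fin n) {k k' : Fin n} (hk' : (k' : ℕ) = (k : ℕ) + 1)
    (j : Fin n) :
    (univ.filter fun a : Fin n => a ≤ k' ∧ j ≤ g a).card =
      (univ.filter fun a : Fin n => a < k ∧ j ≤ g a).card + (if j ≤ g k then 1 else 0) +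
        (if j ≤ g k' then 1 else 0) := by
  rw [heckeStep_peel (fun a => j ≤ g a) k']
  have h : (univ.filter fun a : Fin n => a < k' ∧ j ≤ g a) =
      univ.filter fun a : Fin n => a ≤ k ∧ j ≤ g a :=
    Finset.filter_congr (fun a _ => by rw [heckeStep_lt_succ_iff hk'])
  rw [h, heckeStep_row_self]

/-- The swap `s = (k k+1)` does not move anything across a cut `i ≠ k`:
`s a ≤ i ↔ a ≤ i`. [folklore] -/
theorem heckeStep_swap_le_iff {k k' i : Fin n} (hk' : (k' : ℕ) = (k : ℕ) + 1) (hi : i ≠ k)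
    (a : Fin n) : Equiv.swap k k' a ≤ i ↔ a ≤ i := by
  have hik : (i : ℕ) ≠ (k : ℕ) := fun h => hi (Fin.ext h)
  by_cases hak : a = k
  · rw [hak, Equiv.swap_apply_left, Fin.le_iff_val_le_val, Fin.le_iff_val_le_val, hk']
    omega
  · by_cases hak' : a = k'
    · rw [hak', Equiv.swap_apply_right, Fin.le_iff_val_le_val, Fin.le_iff_val_le_val, hk']
      omega
    · rw [Equiv.swap_apply_of_ne_of_ne hak hak']

/-- Rows `i ≠ k` of the rank matrix are unchanged under `f ↦ f ∘ (k k+1)`. [folklore] -/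
theorem heckeStep_rank_swap_of_ne (f : Fin n → Fin n) {k k' i : Fin n}
    (hk' : (k' : ℕ) = (k : ℕ) + 1) (hi : i ≠ k) (j : Fin n) :
    (univ.filter fun a : Fin n => a ≤ i ∧ j ≤ f (Equiv.swap k k' a)).card =
      (univ.filter fun a : Fin n => a ≤ i ∧ j ≤ f a).card := by
  refine Finset.card_equiv (Equiv.swap k k') (fun a => ?_)
  simp only [Finset.mem_filter, Finset.mem_univ, true_and]
  rw [heckeStep_swap_le_iff hk' hi]

/-- The prefix count `#{a < k : j ≤ f a}` is unchanged under `f ↦ f ∘ (k k+1)`. [folklore] -/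
theorem heckeStep_prefix_swap (f : Fin n → Fin n) {k k' : Fin n}
    (hk' : (k' : ℕ) = (k : ℕ) + 1) (j : Fin n) :
    (univ.filter fun a : Fin n => a < k ∧ j ≤ f (Equiv.swap k k' a)).card =
      (univ.filter fun a : Fin n => a < k ∧ j ≤ f a).card := by
  refine congrArg Finset.card (Finset.filter_congr (fun a _ => ?_))
  refine and_congr_right (fun ha => ?_)
  have hak : a ≠ k := ne_of_lt ha
  have hak' : a ≠ k' := by
    intro h
    rw [h, Fin.lt_def, hk'] at ha
    omega
  rw [Equiv.swap_apply_of_ne_of_ne hak hak']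

/-- Row `k` of the rank matrix of `f ∘ (k k+1)`:
`(f∘s)[k,j] = #{a < k : j ≤ f a} + [j ≤ f (k+1)]`. [folklore] -/
theorem heckeStep_row_self_swap (f : Fin n → Fin n) {k k' : Fin n}
    (hk' : (k' : ℕ) = (k : ℕ) + 1) (j : Fin n) :
    (univ.filter fun a : Fin n => a ≤ k ∧ j ≤ f (Equiv.swap k k' a)).card =
      (univ.filter fun a : Fin n => a < k ∧ j ≤ f a).card + (if j ≤ f k' then 1 else 0) := by
  have h := heckeStep_row_self (fun a => f (Equiv.swap k k' a)) k j
  simp only [Equiv.swap_apply_left] at h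
  rw [heckeStep_prefix_swap f hk' j] at h
  exact h

/-- The prefix count is dominated whenever the whole rank matrix is:
`(∀ i j, f[i,j] ≤ g[i,j]) → #{a < k : j ≤ f a} ≤ #{a < k : j ≤ g a}` (row `k - 1`, or `0 ≤ 0`
when `k = 0`). [folklore] -/
theorem heckeStep_prefix_le (f g : Fin n → Fin n) (k : Fin n)
    (h : ∀ i j : Fin n, (univ.filter fun a : Fin n => a ≤ i ∧ j ≤ f a).card ≤
      (univ.filter fun a : Fin n => a ≤ i ∧ j ≤ g a).card) (j : Fin n) :
    (univ.filter fun a : Fin n => a < k ∧ j ≤ f a).card ≤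
      (univ.filter fun a : Fin n => a < k ∧ j ≤ g a).card := by
  have hkn := k.isLt
  by_cases h0 : (k : ℕ) = 0
  · have he : (univ.filter fun a : Fin n => a < k ∧ j ≤ f a) = ∅ := by
      rw [Finset.filter_eq_empty_iff]
      intro a _ ha
      have := Fin.lt_def.1 ha.1
      omega
    rw [he, Finset.card_empty]
    exact Nat.zero_le _
  · have hi : ∀ a : Fin n, a < k ↔ a ≤ (⟨(k : ℕ) - 1, by omega⟩ : Fin n) := fun a => by
      rw [Fin.lt_def, Fin.le_iff_val_le_val]
      simp only
      omega
    simp only [hi]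
    exact h _ j

/-- `[j ≤ x] ≤ [j ≤ y]` for `x < y`. [folklore] -/
theorem heckeStep_ind_mono {x y : Fin n} (j : Fin n) (h : x < y) :
    (if j ≤ x then 1 else 0) ≤ (if j ≤ y then 1 else 0) := by
  by_cases hx : j ≤ x
  · rw [if_pos hx, if_pos (hx.trans h.le)]
  · rw [if_neg hx]
    exact Nat.zero_le _

/-- **The lifting property in rank form** (Björner–Brenti 2005, Prop. 2.2.7, from the rank
criterion Thm 2.1.5).  Let `s = (k k+1)` and let `σ`, `w` both have an ascent at `k`.  Then
`σ ≤ w s ↔ σ ≤ w` and `σ s ≤ w s ↔ σ ≤ w`, where `f ≤ g` means `∀ i j, f[i,j] ≤ g[i,j]` with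
`f[i,j] = #{a ≤ i : j ≤ f a}`.  (Stated for arbitrary maps `Fin n → Fin n`.)
[cite: BjornerBrenti2005, Prop 2.2.7] -/
theorem heckeStep_bruhat_iff (σ w : Fin n → Fin n) {k k' : Fin n}
    (hk' : (k' : ℕ) = (k : ℕ) + 1) (hσ : σ k < σ k') (hw : w k < w k') :
    ((∀ i j : Fin n, (univ.filter fun a : Fin n => a ≤ i ∧ j ≤ σ a).card ≤
        (univ.filter fun a : Fin n => a ≤ i ∧ j ≤ w (Equiv.swap k k' a)).card) ↔
      ∀ i j : Fin n, (univ.filter fun a : Fin n => a ≤ i ∧ j ≤ σ a).card ≤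
        (univ.filter fun a : Fin n => a ≤ i ∧ j ≤ w a).card) ∧
    ((∀ i j : Fin n, (univ.filter fun a : Fin n => a ≤ i ∧ j ≤ σ (Equiv.swap k k' a)).card ≤
        (univ.filter fun a : Fin n => a ≤ i ∧ j ≤ w (Equiv.swap k k' a)).card) ↔
      ∀ i j : Fin n, (univ.filter fun a : Fin n => a ≤ i ∧ j ≤ σ a).card ≤
        (univ.filter fun a : Fin n => a ≤ i ∧ j ≤ w a).card) := by
  have hkk' : k' ≠ k := by
    intro h
    have := congrArg Fin.val h
    omega
  refine ⟨⟨fun h i j => ?_, fun h i j => ?_⟩, ⟨fun h i j => ?_, fun h i j => ?_⟩⟩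
  · by_cases hi : i = k
    · rw [hi, heckeStep_row_self σ, heckeStep_row_self w]
      have h1 := h k j
      have h2 := h k' j
      have h3 := heckeStep_prefix_le σ (fun a => w (Equiv.swap k k' a)) k h j
      rw [heckeStep_row_self σ, heckeStep_row_self_swap w hk'] at h1
      rw [heckeStep_row_succ σ hk', heckeStep_rank_swap_of_ne w hk' hkk',
        heckeStep_row_succ w hk'] at h2
      rw [heckeStep_prefix_swap w hk'] at h3
      have m1 := heckeStep_ind_mono j hσ
      have m2 : (if j ≤ σ k' then 1 else 0) ≤ 1 := by split_ifs <;> omega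
      have m3 := heckeStep_ind_mono j hw
      have m4 : (if j ≤ w k' then 1 else 0) ≤ 1 := by split_ifs <;> omega
      omega
    · rw [← heckeStep_rank_swap_of_ne w hk' hi j]
      exact h i j
  · by_cases hi : i = k
    · rw [hi, heckeStep_row_self σ, heckeStep_row_self_swap w hk']
      have h1 := h k j
      rw [heckeStep_row_self σ, heckeStep_row_self w] at h1
      have m3 := heckeStep_ind_mono j hw
      omega
    · rw [heckeStep_rank_swap_of_ne w hk' hi j]
      exact h i j
  · by_cases hi : i = k
    · rw [hi, heckeStep_row_self σ, heckeStep_row_self w]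
      have h1 := h k j
      have h2 := h k' j
      have h3 := heckeStep_prefix_le (fun a => σ (Equiv.swap k k' a))
        (fun a => w (Equiv.swap k k' a)) k h j
      rw [heckeStep_row_self_swap σ hk', heckeStep_row_self_swap w hk'] at h1
      rw [heckeStep_rank_swap_of_ne σ hk' hkk', heckeStep_rank_swap_of_ne w hk' hkk',
        heckeStep_row_succ σ hk', heckeStep_row_succ w hk'] at h2
      rw [heckeStep_prefix_swap σ hk', heckeStep_prefix_swap w hk'] at h3
      have m1 := heckeStep_ind_mono j hσ
      have m2 : (if j ≤ σ k' then 1 else 0) ≤ 1 := by split_ifs <;> omega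
      have m3 := heckeStep_ind_mono j hw
      have m4 : (if j ≤ w k' then 1 else 0) ≤ 1 := by split_ifs <;> omega
      omega
    · rw [← heckeStep_rank_swap_of_ne σ hk' hi j, ← heckeStep_rank_swap_of_ne w hk' hi j]
      exact h i j
  · by_cases hi : i = k
    · rw [hi, heckeStep_row_self_swap σ hk', heckeStep_row_self_swap w hk']
      have h1 := h k j
      have h2 := h k' j
      have h3 := heckeStep_prefix_le σ w k h j
      rw [heckeStep_row_self σ, heckeStep_row_self w] at h1
      rw [heckeStep_row_succ σ hk', heckeStep_row_succ w hk'] at h2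
      have m1 := heckeStep_ind_mono j hσ
      have m2 : (if j ≤ σ k' then 1 else 0) ≤ 1 := by split_ifs <;> omega
      have m3 := heckeStep_ind_mono j hw
      have m4 : (if j ≤ w k' then 1 else 0) ≤ 1 := by split_ifs <;> omega
      omega
    · rw [heckeStep_rank_swap_of_ne σ hk' hi j, heckeStep_rank_swap_of_ne w hk' hi j]
      exact h i j

end Rank

/-! ## The item -/

/-- **Settles `stmt-ValiantsHypothesis-13596` (`PartialSorting.HeckeStep`).**  One 0-Hecke gate
per weak-order cover: if `w k < w (k+1)` and `s = (k k+1)` then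
`D_{w s} = Σ_{u ≤ w, u k < u (k+1)} sgn u · (x^u − x^{u s})` as an identity in
`MvPolynomial (Fin n × Fin n) ℂ`, with `≤` the Bruhat order via the Björner–Brenti rank criterion.
Proof: split `Σ_{σ ≤ ws}` by ascent/descent at `k`, reindex descents by `σ ↦ σ s`
(`heckeStep_sum_split`), and use the rank-form lifting property `heckeStep_bruhat_iff`.
[cite: BjornerBrenti2005, Prop 2.2.7] -/
theorem heckeStep_proof :
    Summit.ValiantsHypothesis.ValiantsHypothesis.Theses.PartialSorting.HeckeStep := by
  intro n w k hk hw
  simp only [Equiv.Perm.coe_mul, Function.comp_apply]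
  have hk' : (((⟨(k : ℕ) + 1, hk⟩ : Fin n) : ℕ)) = (k : ℕ) + 1 := rfl
  have hkk' : k ≠ ⟨(k : ℕ) + 1, hk⟩ := by
    intro h
    have := congrArg Fin.val h
    simp only at this
    omega
  refine heckeStep_sum_split (Equiv.mulRight (Equiv.swap k ⟨(k : ℕ) + 1, hk⟩))
    (fun σ : Equiv.Perm (Fin n) => ∀ i j : Fin n,
      (univ.filter fun a : Fin n => a ≤ i ∧ j ≤ σ a).card ≤
        (univ.filter fun a : Fin n => a ≤ i ∧ j ≤ w (Equiv.swap k ⟨(k : ℕ) + 1, hk⟩ a)).card)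
    (fun σ : Equiv.Perm (Fin n) => ∀ i j : Fin n,
      (univ.filter fun a : Fin n => a ≤ i ∧ j ≤ σ a).card ≤
        (univ.filter fun a : Fin n => a ≤ i ∧ j ≤ w a).card)
    (fun σ : Equiv.Perm (Fin n) => σ k < σ ⟨(k : ℕ) + 1, hk⟩)
    (fun σ : Equiv.Perm (Fin n) => Equiv.Perm.sign σ)
    (fun σ : Equiv.Perm (Fin n) => ∏ a : Fin n, MvPolynomial.X (a, σ a))
    (fun σ : Equiv.Perm (Fin n) => ∏ a : Fin n, MvPolynomial.X (a, σ (Equiv.swap k ⟨(k : ℕ) + 1, hk⟩ a)))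
    ?_ ?_ ?_ ?_ ?_
  · -- the reindexing exchanges ascents and descents at `k`
    intro u
    simp only [Equiv.coe_mulRight, Equiv.Perm.mul_apply, Equiv.swap_apply_left,
      Equiv.swap_apply_right]
    have hne : u k ≠ u ⟨(k : ℕ) + 1, hk⟩ := fun h => hkk' (u.injective h)
    constructor
    · exact fun h h' => lt_asymm h h'
    · exact fun h => lt_of_le_of_ne (not_lt.1 h) (Ne.symm hne)
  · -- the sign flips
    intro u
    simp only [Equiv.coe_mulRight, Equiv.Perm.sign_mul, Equiv.Perm.sign_swap hkk', mul_neg_one]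
  · -- the monomial is carried along
    intro u
    rfl
  · -- ascents: `u ≤ w s ↔ u ≤ w`
    intro u hu
    exact (heckeStep_bruhat_iff (⇑u) (⇑w) hk' hu hw).1
  · -- ascents: `u s ≤ w s ↔ u ≤ w`
    intro u hu
    simp only [Equiv.coe_mulRight, Equiv.Perm.mul_apply]
    exact (heckeStep_bruhat_iff (⇑u) (⇑w) hk' hu hw).2

end Summit.ValiantsHypothesis.ValiantsHypothesis.Theorems.PartialSortingHeckeStep
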